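import Literature.AlgebraicGeometry.Motives.SchemePairLongExactSequence
import Literature.AlgebraicGeometry.Motives.MixedHodgeStructureStrictProofs
import Literature.AlgebraicGeometry.Motives.HodgeStructureWeil
import Literature.AlgebraicGeometry.Motives.WeilTypeCMProofs
import HarnessLib

/-!
# Exactness of the Hodge pieces of mixed Hodge structures; the Hodge-number box of a pair from the boxes of its two varieties

Theorems-only companion of `Literature/AlgebraicGeometry/Motives/MixedHodgeStructureOfPair.lean`
(the hypothesis structure `MixedHodgeStructureOfPair k` and its named fact
`MixedHodgeStructureOfPair.existsDeligne`, Deligne, *Théorie de Hodge III*, 8.2.4, 8.3.8–8.3.9).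
It formalises one step of the printed proof of the axioms of that structure, the only one the
tree can carry today: the passage from Deligne's Hodge-number box for the cohomology of a
*variety* (Hodge III, Thm. 8.2.4: `h^{p,q}(Hⁿ(X)) = 0` unless `0 ≤ p, q ≤ n`) to the box for the
relative cohomology `Hⁿ(X, D)` of a *pair* (the axiom `piece_eq_bot_of_not_mem_box` of
`MixedHodgeStructureOfPair`), through the long exact sequence of the pair, which is an exact
sequence of mixed Hodge structures (Hodge III, 8.3.9; Cattani–El Zein–Griffiths–Lê, §3.4.2.12,
Problem (1)), and the exactness of the functors `H ↦ (Gr^W_{p+q} H)^{p,q}` on mixed Hodge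
structures (Deligne, *Théorie de Hodge II*, Thm. 2.3.5 (iv): "le foncteur `Gr_W^n Gr_F^p`
est exact"; Thm. 1.2.10 (iv)).

## Main results

Abstract layer (namespace `MixedHodgeStructure`; `I^{p,q} = deligneI p q` is Deligne's splitting of
`MixedHodgeStructureSplitting.lean`, the morphisms are the tree's bundled `Hom`, complexified
maps `f_ℂ = f.toLinearMap.baseChange ℂ`):

* `grLift_injective`, `hodgePreimage_eq_deligneI_sup`, `piece_gr_eq_bot_iff_deligneI_eq_bot` —
  the Hodge piece `(Gr^W_{p+q})^{p,q}` vanishes iff `I^{p,q} = 0` (`I^{p,q} ≅ (Gr^W_{p+q})^{p,q}`,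
  Cattani et al., Prop. 3.2.19).
* `Hom.deligneI_inf_range_le_map`, `Hom.map_deligneI_eq` — **morphisms are strict for the
  splitting**: `f_ℂ(I^{p,q}(H₁)) = I^{p,q}(H₂) ∩ im f_ℂ` (a morphism is bigraded for Deligne's
  decompositions, Deligne, Hodge II, 1.2.10–1.2.11; Cattani et al., Remark (ii) after
  Prop. 3.2.19), from the strictness for `W` of `MixedHodgeStructureStrictProofs.lean` and the
  direct-sum decomposition `W_n = ⊕_p I^{p,n-p} ⊕ W_{n-1}` of `MixedHodgeStructureSplitting.lean`.
* `Hom.deligneI_inf_ker_eq_map_of_exact` — **exactness of `I^{p,q}`**: for an exact sequence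
  `H₁ → H₂ → H₃` of mixed Hodge structures, `I^{p,q}(H₂) ∩ ker g_ℂ = f_ℂ(I^{p,q}(H₁))`
  (Deligne, Hodge II, Thm. 2.3.5 (iv) / 1.2.10 (iv)); the vanishing consequences
  `Hom.deligneI_eq_bot_of_exact`, `Hom.deligneI_eq_bot_of_injective`,
  `Hom.deligneI_eq_bot_of_surjective` and their Hodge-piece forms
  **`Hom.piece_gr_eq_bot_of_exact`** (the `(p, q)`-piece of the middle term of an exact sequence
  vanishes when those of the outer terms do), `Hom.piece_gr_eq_bot_of_injective`,
  `Hom.piece_gr_eq_bot_of_surjective` (Hodge types of sub- and quotient structures).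

Pairs (namespace `SchemePair`, for the tree's relative Betti cohomology
`bettiCohomology Y n = Hⁿ(X(ℂ), D(ℂ); ℚ)` and the pair-form long exact sequence of
`SchemePairLongExactSequence.lean`):

* `SchemePair.injective_map_ofSchemeHom_zero` — `H⁰((X, D)) → H⁰((X, ∅))` is injective
  (Hatcher, §3.1: there are no `(-1)`-cochains).
* **`SchemePair.piece_gr_eq_bot_of_not_mem_box_succ`**, **`SchemePair.piece_gr_eq_bot_of_not_mem_box_zero`**
  — for ANY mixed Hodge structures on `Hⁿ((D, ∅))`, `Hⁿ⁺¹((X, D))`, `Hⁿ⁺¹((X, ∅))` (resp. on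
  `H⁰((X, D))`, `H⁰((X, ∅))`) for which the connecting map and the pull-back along
  `(X, ∅) → (X, D)` underlie morphisms of mixed Hodge structures, the Hodge-number boxes
  `[0, n]²` of `Hⁿ((D, ∅))` and `[0, n+1]²` of `Hⁿ⁺¹((X, ∅))` give the box `[0, n+1]²` of
  `Hⁿ⁺¹((X, D))` (resp. the box of `H⁰((X, ∅))` gives that of `H⁰((X, D))`): Hodge III, 8.2.4
  for `X` and `D` ⟹ 8.2.4 for the pair, via 8.3.9.
* **`MixedHodgeStructureOfPair.nonempty_of_box_ofScheme`** — consequently the hypothesis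
  structure is inhabited as soon as one has data `mhs` satisfying `map_hom`, `boundary_hom`,
  `isPure` and the box axiom **for pairs of the form `(X, ∅)` only** (`X` a variety): the box
  for general pairs of varieties is a theorem. This is the reduction of the fifth axiom of
  `existsDeligne` to Deligne's Thm. 8.2.4 as printed (for varieties / simplicial schemes).

Parity (what any inhabitant already contains):

* `HodgeStructure.even_finrank_of_odd`, `MixedHodgeStructure.even_finrank_of_isPure_odd` — a
  `ℚ`-Hodge structure of odd weight `n = 2m + 1` (resp. a mixed Hodge structure pure of odd
  weight) lives on an even-dimensional space: `V_ℂ = F^{m+1} ⊕ conj F^{m+1}` and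
  `dim conj F^{m+1} = dim F^{m+1}` (the linear algebra of Voisin, *Hodge Theory I*, Cor. 6.13).
* **`MixedHodgeStructureOfPair.even_finrank_bettiCohomology_of_odd`**,
  `MixedHodgeStructureOfPair.existsDeligne.even_finrank_bettiCohomology_of_odd` — for every
  inhabitant `M : MixedHodgeStructureOfPair k` (in particular under `existsDeligne`) the odd Betti
  numbers `dim_ℚ H^{2j+1}(X(ℂ); ℚ)` of a smooth projective `k`-variety `X` are even (axiom
  `isPure`; Voisin I, Cor. 6.13: "The odd Betti numbers of a compact Kähler manifold are even").
  This makes precise the remark below: no inhabitant can be produced short of the Hodge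
  decomposition, since already this numerical shadow of `isPure` is Hodge theory.

## What this does NOT do

`existsDeligne` itself (inhabitedness of `MixedHodgeStructureOfPair k` for every `k ⊆ ℂ`) is not
discharged here. Any inhabitant restricts, on `Hⁿ(X(ℂ); ℚ)` for `X` smooth projective and `n`
odd, to a half-dimensional `F^{(n+1)/2} ⊆ Hⁿ(X(ℂ); ℂ)` complementary to its conjugate and
functorial in `X` (axioms `isPure`, `map_hom`; `even_finrank_bettiCohomology_of_odd`), i.e. to
(Weil's half of) the classical Hodge decomposition, which
the tree holds only as the undischarged named fact `isInternal_hodgePQ`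
(`HodgeDecomposition.lean`; itself resting on the Hodge theorem for the Laplacian and the Kähler
identities), followed by the de Rham and comparison theorems, resolution of singularities
(`Resolution.Hironaka1964`), logarithmic de Rham complexes, mixed Hodge complexes and
cohomological descent (Hodge II §3, Hodge III §8.1), none of which is in the tree or in Mathlib.
No named fact is introduced here (D-0026).

## References

* P. Deligne, *Théorie de Hodge II*, Publ. Math. IHÉS 40 (1971), Thm. 1.2.10, 1.2.11,
  Thm. 2.3.5 (iii)–(iv). [DeligneHodgeII1971]
* P. Deligne, *Théorie de Hodge III*, Publ. Math. IHÉS 44 (1974), Thm. 8.2.4, 8.3.8–8.3.9.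
  [DeligneHodgeIII1974]
* E. Cattani, F. El Zein, P. Griffiths, Lê D. T. (eds.), *Hodge Theory*, Math. Notes 49 (2014),
  Ch. 3: Prop. 3.2.19 and Remark (ii), Cor. 3.2.21, Prop. 3.4.22 (iii), §3.4.2.12 Problem (1).
  [CattaniElZeinGriffithsLe2014]
* S. Ishii, *Introduction to Singularities*, 2nd ed. (2018), Prop. 8.1.4, Thm. 8.1.6.
  [IshiiSingularities2018]
* A. Hatcher, *Algebraic Topology* (2002), §3.1, pp. 199–200. [Hatcher2002]
* C. Voisin, *Hodge Theory and Complex Algebraic Geometry I* (2002), §6.1.3, Cor. 6.13 (p. 142).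
  [VoisinHodgeI2002]
-/

open scoped TensorProduct

noncomputable section

namespace Literature.AlgebraicGeometry.Motives

namespace MixedHodgeStructure

universe u v w

variable {V₁ : Type u} [AddCommGroup V₁] [Module ℚ V₁]
variable {V₂ : Type v} [AddCommGroup V₂] [Module ℚ V₂]
variable {V₃ : Type w} [AddCommGroup V₃] [Module ℚ V₃]

/-! ### Hodge pieces of `Gr^W` and Deligne's `I^{p,q}` -/

section Pieces

variable (H : MixedHodgeStructure V₁)

/-- The transport `grLift` of subspaces of `ℂ ⊗ Gr^W_n` to subspaces of `V_ℂ` (pull back along the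
surjection `W_{n,ℂ} → ℂ ⊗ Gr^W_n`, push forward along the injection `W_{n,ℂ} → V_ℂ`) is injective.
[folklore] -/
theorem grLift_injective (n : ℤ) : Function.Injective (H.grLift n) := fun _ _ h =>
  Submodule.comap_injective_of_surjective (grProj_surjective H.W n)
    (Submodule.map_injective_of_injective (grIncl_injective H.W n) h)

/-- The preimage in `V_ℂ` of the Hodge piece `(Gr^W_{p+q})^{p,q}` is `I^{p,q} + W_{p+q-1,ℂ}`
(`I^{p,q}` maps isomorphically onto the piece: Cattani–El Zein–Griffiths–Lê, Prop. 3.2.19;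
the two inclusions are `hodgePreimage_le_deligneI_sup` and `deligneI_le_hodgePreimage` of
`MixedHodgeStructureSplitting.lean`). [cite: CattaniElZeinGriffithsLe2014, Prop. 3.2.19] -/
theorem hodgePreimage_eq_deligneI_sup (p q : ℤ) :
    H.hodgePreimage p q = H.deligneI p q ⊔ (H.W (p + q - 1)).baseChange ℂ :=
  le_antisymm (H.hodgePreimage_le_deligneI_sup p q)
    (sup_le (H.deligneI_le_hodgePreimage p q) (H.W_pred_le_hodgePreimage p q))

/-- **The Hodge piece `(Gr^W_{p+q} V)^{p,q}` of a mixed Hodge structure vanishes iff Deligne's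
`I^{p,q}` vanishes** (`I^{p,q} ≅ (Gr^W_{p+q})^{p,q}`, Deligne, Hodge II, 1.2.8; Cattani et al.,
Prop. 3.2.19): transported to `V_ℂ`, the piece is `I^{p,q} ⊕ W_{p+q-1,ℂ}` over `W_{p+q-1,ℂ}`.
[cite: CattaniElZeinGriffithsLe2014, Prop. 3.2.19] -/
theorem piece_gr_eq_bot_iff_deligneI_eq_bot (p q : ℤ) :
    (H.gr (p + q)).piece p q = ⊥ ↔ H.deligneI p q = ⊥ := by
  have hlift : H.grLift (p + q) ((H.gr (p + q)).piece p q) = H.hodgePreimage p q := by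
    have h := H.grLift_piece (p + q) p
    rwa [add_sub_cancel_left] at h
  have hbot := H.grLift_bot (p + q)
  have hdisj := H.deligneI_inf_W_pred_eq_bot p q
  constructor
  · intro h
    have hpre : H.hodgePreimage p q = (H.W (p + q - 1)).baseChange ℂ := by rw [← hlift, h, hbot]
    rw [H.hodgePreimage_eq_deligneI_sup] at hpre
    have hle : H.deligneI p q ≤ (H.W (p + q - 1)).baseChange ℂ := le_sup_left.trans hpre.le
    have h2 : H.deligneI p q ≤ H.deligneI p q ⊓ (H.W (p + q - 1)).baseChange ℂ := le_inf le_rfl hle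
    rw [hdisj] at h2
    exact eq_bot_iff.2 h2
  · intro h
    apply H.grLift_injective (p + q)
    rw [hlift, hbot, H.hodgePreimage_eq_deligneI_sup, h, bot_sup_eq]

end Pieces

/-! ### Morphisms are strict for Deligne's splitting; exactness of `I^{p,q}` -/

namespace Hom

variable {H₁ : MixedHodgeStructure V₁} {H₂ : MixedHodgeStructure V₂} {H₃ : MixedHodgeStructure V₃}

/-- **A morphism of mixed Hodge structures is strict for Deligne's splitting**: every element
of `I^{p,q}(H₂)` in the image of `f_ℂ` is the image of an element of `I^{p,q}(H₁)` — morphisms are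
bigraded for the decompositions `V_ℂ = ⊕ I^{p,q}` (Deligne, Hodge II, 1.2.10–1.2.11; Cattani–El
Zein–Griffiths–Lê, Remark (ii) after Prop. 3.2.19). Proof: by strictness for `W`
(`map_baseChange_W_eq`) choose a preimage `x ∈ W_{p+q,ℂ}`; write `x = j_p + j' + w` along
`W_n = I^{p,n-p} ⊕ (⊕_{i ≠ p} I^{i,n-i}) ⊕ W_{n-1}` (`W_eq_iSup_deligneI_sup`); the images of the
three summands lie in the corresponding summands of `H₂`, where the decomposition is direct
(`iSupIndep_deligneI`, `iSup_deligneI_inf_W_pred_eq_bot`), so `f_ℂ j' = f_ℂ w = 0` and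
`y = f_ℂ j_p`. [cite: DeligneHodgeII1971, Thm. 1.2.10] -/
theorem deligneI_inf_range_le_map (f : Hom H₁ H₂) (p q : ℤ) :
    H₂.deligneI p q ⊓ LinearMap.range (f.toLinearMap.baseChange ℂ) ≤
      (H₁.deligneI p q).map (f.toLinearMap.baseChange ℂ) := by
  rintro y ⟨hyI, hyr⟩
  -- a preimage of weight `p + q` (strictness for `W`)
  have hx : y ∈ ((H₁.W (p + q)).baseChange ℂ).map (f.toLinearMap.baseChange ℂ) := by
    rw [f.map_baseChange_W_eq]
    exact ⟨H₂.deligneI_le_W p q hyI, hyr⟩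
  obtain ⟨x, hxW, rfl⟩ := hx
  -- decompose `x = jp + j' + w`
  rw [H₁.W_eq_iSup_deligneI_sup (p + q)] at hxW
  obtain ⟨j, hj, w, hw, rfl⟩ := Submodule.mem_sup.1 hxW
  rw [iSup_split_single _ p, add_sub_cancel_left] at hj
  obtain ⟨jp, hjp, j', hj', rfl⟩ := Submodule.mem_sup.1 hj
  have hfjp : f.toLinearMap.baseChange ℂ jp ∈ H₂.deligneI p q :=
    f.map_deligneI_le p q ⟨jp, hjp, rfl⟩
  have hfj' : f.toLinearMap.baseChange ℂ j' ∈ ⨆ (i) (_ : i ≠ p), H₂.deligneI i (p + q - i) := by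
    have h := f.map_biSup_deligneI_le {i | i ≠ p} (p + q) ⟨j', hj', rfl⟩
    simpa only [Set.mem_setOf_eq] using h
  have hfw : f.toLinearMap.baseChange ℂ w ∈ (H₂.W (p + q - 1)).baseChange ℂ :=
    f.map_baseChange_W_le (p + q - 1) ⟨w, hw, rfl⟩
  have hle₁ : H₂.deligneI p q ≤ ⨆ i, H₂.deligneI i (p + q - i) :=
    le_iSup_of_le p (by
      show H₂.deligneI p q ≤ H₂.deligneI p (p + q - p)
      rw [add_sub_cancel_left])
  have hle₂ : (⨆ (i) (_ : i ≠ p), H₂.deligneI i (p + q - i)) ≤ ⨆ i, H₂.deligneI i (p + q - i) :=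
    iSup₂_le fun i _ => le_iSup (fun i => H₂.deligneI i (p + q - i)) i
  -- `f w = f x - f jp - f j' ∈ (⊕ I) ∩ W_{p+q-1} = 0`
  have hw0 : f.toLinearMap.baseChange ℂ w = 0 := by
    have h1 : f.toLinearMap.baseChange ℂ w ∈ ⨆ i, H₂.deligneI i (p + q - i) := by
      have he : f.toLinearMap.baseChange ℂ w = f.toLinearMap.baseChange ℂ (jp + j' + w) -
          f.toLinearMap.baseChange ℂ jp - f.toLinearMap.baseChange ℂ j' := by
        rw [map_add, map_add]; abel
      rw [he]
      exact Submodule.sub_mem _ (Submodule.sub_mem _ (hle₁ hyI) (hle₁ hfjp)) (hle₂ hfj')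
    have h2 : f.toLinearMap.baseChange ℂ w ∈
        (⨆ i, H₂.deligneI i (p + q - i)) ⊓ (H₂.W (p + q - 1)).baseChange ℂ := ⟨h1, hfw⟩
    rwa [H₂.iSup_deligneI_inf_W_pred_eq_bot, Submodule.mem_bot] at h2
  -- `f j' = f x - f jp ∈ I^{p,q} ∩ ⊕_{i ≠ p} I^{i,p+q-i} = 0`
  have hj'0 : f.toLinearMap.baseChange ℂ j' = 0 := by
    have h1 : f.toLinearMap.baseChange ℂ j' ∈ H₂.deligneI p q := by
      have he : f.toLinearMap.baseChange ℂ j' = f.toLinearMap.baseChange ℂ (jp + j' + w) -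
          f.toLinearMap.baseChange ℂ jp - f.toLinearMap.baseChange ℂ w := by
        rw [map_add, map_add]; abel
      rw [he, hw0, sub_zero]
      exact Submodule.sub_mem _ hyI hfjp
    have hdis : Disjoint (H₂.deligneI p (p + q - p)) (⨆ (i) (_ : i ≠ p), H₂.deligneI i (p + q - i)) :=
      H₂.iSupIndep_deligneI (p + q) p
    rw [add_sub_cancel_left, disjoint_iff] at hdis
    have h2 : f.toLinearMap.baseChange ℂ j' ∈
        H₂.deligneI p q ⊓ ⨆ (i) (_ : i ≠ p), H₂.deligneI i (p + q - i) := ⟨h1, hfj'⟩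
    rwa [hdis, Submodule.mem_bot] at h2
  refine ⟨jp, hjp, ?_⟩
  rw [map_add, map_add, hw0, hj'0, add_zero, add_zero]

/-- **Strictness for the splitting**: `f_ℂ(I^{p,q}(H₁)) = I^{p,q}(H₂) ∩ im f_ℂ`
(Deligne, Hodge II, 1.2.10–1.2.11; Cattani et al., Remark (ii) after Prop. 3.2.19).
[cite: DeligneHodgeII1971, Thm. 1.2.10] -/
theorem map_deligneI_eq (f : Hom H₁ H₂) (p q : ℤ) :
    (H₁.deligneI p q).map (f.toLinearMap.baseChange ℂ) =
      H₂.deligneI p q ⊓ LinearMap.range (f.toLinearMap.baseChange ℂ) :=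
  le_antisymm (le_inf (f.map_deligneI_le p q) LinearMap.map_le_range)
    (f.deligneI_inf_range_le_map p q)

/-- **Exactness of Deligne's `I^{p,q}`** along an exact sequence `H₁ → H₂ → H₃` of mixed Hodge
structures: `I^{p,q}(H₂) ∩ ker g_ℂ = f_ℂ(I^{p,q}(H₁))` (Deligne, *Théorie de Hodge II*,
Thm. 2.3.5 (iv) with 1.2.10 (iv): `Gr_W Gr_F` is exact; here through the splitting). Exactness
over `ℚ` passes to `ℂ` by flatness. [cite: DeligneHodgeII1971, Thm. 2.3.5 (iv)] -/
theorem deligneI_inf_ker_eq_map_of_exact {f : Hom H₁ H₂} {g : Hom H₂ H₃}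
    (hfg : Function.Exact f.toLinearMap g.toLinearMap) (p q : ℤ) :
    H₂.deligneI p q ⊓ LinearMap.ker (g.toLinearMap.baseChange ℂ) =
      (H₁.deligneI p q).map (f.toLinearMap.baseChange ℂ) := by
  have hC : Function.Exact (f.toLinearMap.baseChange ℂ) (g.toLinearMap.baseChange ℂ) :=
    Module.Flat.lTensor_exact ℂ hfg
  rw [hC.linearMap_ker_eq, f.map_deligneI_eq]

/-- In an exact sequence `H₁ → H₂ → H₃` of mixed Hodge structures, `I^{p,q}(H₂) = 0` as soon
as `I^{p,q}(H₁) = 0` and `I^{p,q}(H₃) = 0` (Deligne, Hodge II, Thm. 2.3.5 (iv)).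
[cite: DeligneHodgeII1971, Thm. 2.3.5 (iv)] -/
theorem deligneI_eq_bot_of_exact {f : Hom H₁ H₂} {g : Hom H₂ H₃}
    (hfg : Function.Exact f.toLinearMap g.toLinearMap) {p q : ℤ}
    (h₁ : H₁.deligneI p q = ⊥) (h₃ : H₃.deligneI p q = ⊥) : H₂.deligneI p q = ⊥ := by
  rw [eq_bot_iff]
  intro y hy
  have hyker : y ∈ LinearMap.ker (g.toLinearMap.baseChange ℂ) := by
    rw [LinearMap.mem_ker, ← Submodule.mem_bot ℂ, ← h₃]
    exact g.map_deligneI_le p q ⟨y, hy, rfl⟩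
  have h : y ∈ (H₁.deligneI p q).map (f.toLinearMap.baseChange ℂ) := by
    rw [← deligneI_inf_ker_eq_map_of_exact hfg]
    exact ⟨hy, hyker⟩
  rwa [h₁, Submodule.map_bot] at h

/-- Under an injective morphism `H₁ → H₂` (a sub-mixed Hodge structure), `I^{p,q}(H₁) = 0` as
soon as `I^{p,q}(H₂) = 0`. [cite: DeligneHodgeII1971, Thm. 2.3.5 (iv)] -/
theorem deligneI_eq_bot_of_injective (f : Hom H₁ H₂) (hf : Function.Injective f.toLinearMap)
    {p q : ℤ} (h₂ : H₂.deligneI p q = ⊥) : H₁.deligneI p q = ⊥ := by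
  rw [eq_bot_iff]
  intro y hy
  have h : f.toLinearMap.baseChange ℂ y ∈ H₂.deligneI p q := f.map_deligneI_le p q ⟨y, hy, rfl⟩
  rw [h₂, Submodule.mem_bot] at h
  exact (Submodule.mem_bot ℂ).2 (baseChange_injective hf (h.trans (map_zero _).symm))

/-- Under a surjective morphism `H₂ → H₃` (a quotient mixed Hodge structure), `I^{p,q}(H₃) = 0`
as soon as `I^{p,q}(H₂) = 0`. [cite: DeligneHodgeII1971, Thm. 2.3.5 (iv)] -/
theorem deligneI_eq_bot_of_surjective (g : Hom H₂ H₃) (hg : Function.Surjective g.toLinearMap)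
    {p q : ℤ} (h₂ : H₂.deligneI p q = ⊥) : H₃.deligneI p q = ⊥ := by
  rw [eq_bot_iff]
  intro z hz
  obtain ⟨y, rfl⟩ := LinearMap.baseChange_surjective ℂ hg z
  have h : g.toLinearMap.baseChange ℂ y ∈ (H₂.deligneI p q).map (g.toLinearMap.baseChange ℂ) :=
    g.deligneI_inf_range_le_map p q ⟨hz, LinearMap.mem_range_self _ y⟩
  rwa [h₂, Submodule.map_bot] at h

/-- **Exactness of the Hodge pieces** (Deligne, *Théorie de Hodge II*, Thm. 2.3.5 (iv): the
functor `H ↦ Gr_F^p Gr^W_{p+q} H ≅ (Gr^W_{p+q} H)^{p,q}` is exact): in an exact sequence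
`H₁ → H₂ → H₃` of mixed `ℚ`-Hodge structures the `(p, q)`-piece of `Gr^W_{p+q} H₂` vanishes as
soon as those of `H₁` and `H₃` do — equivalently `h^{p,q}(H₂) = 0` if `h^{p,q}(H₁) = h^{p,q}(H₃) = 0`
(Ishii, Prop. 8.1.4). [cite: DeligneHodgeII1971, Thm. 2.3.5 (iv)] -/
theorem piece_gr_eq_bot_of_exact {f : Hom H₁ H₂} {g : Hom H₂ H₃}
    (hfg : Function.Exact f.toLinearMap g.toLinearMap) {p q : ℤ}
    (h₁ : (H₁.gr (p + q)).piece p q = ⊥) (h₃ : (H₃.gr (p + q)).piece p q = ⊥) :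
    (H₂.gr (p + q)).piece p q = ⊥ :=
  (H₂.piece_gr_eq_bot_iff_deligneI_eq_bot p q).2
    (deligneI_eq_bot_of_exact hfg ((H₁.piece_gr_eq_bot_iff_deligneI_eq_bot p q).1 h₁)
      ((H₃.piece_gr_eq_bot_iff_deligneI_eq_bot p q).1 h₃))

/-- Hodge types of a sub-structure: under an injective morphism `H₁ → H₂`, the `(p, q)`-piece of
`Gr^W_{p+q} H₁` vanishes where that of `H₂` does. [cite: DeligneHodgeII1971, Thm. 2.3.5 (iv)] -/
theorem piece_gr_eq_bot_of_injective (f : Hom H₁ H₂) (hf : Function.Injective f.toLinearMap)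
    {p q : ℤ} (h₂ : (H₂.gr (p + q)).piece p q = ⊥) : (H₁.gr (p + q)).piece p q = ⊥ :=
  (H₁.piece_gr_eq_bot_iff_deligneI_eq_bot p q).2
    (f.deligneI_eq_bot_of_injective hf ((H₂.piece_gr_eq_bot_iff_deligneI_eq_bot p q).1 h₂))

/-- Hodge types of a quotient structure: under a surjective morphism `H₂ → H₃`, the `(p, q)`-piece
of `Gr^W_{p+q} H₃` vanishes where that of `H₂` does. [cite: DeligneHodgeII1971, Thm. 2.3.5 (iv)] -/
theorem piece_gr_eq_bot_of_surjective (g : Hom H₂ H₃) (hg : Function.Surjective g.toLinearMap)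
    {p q : ℤ} (h₂ : (H₂.gr (p + q)).piece p q = ⊥) : (H₃.gr (p + q)).piece p q = ⊥ :=
  (H₃.piece_gr_eq_bot_iff_deligneI_eq_bot p q).2
    (g.deligneI_eq_bot_of_surjective hg ((H₂.piece_gr_eq_bot_iff_deligneI_eq_bot p q).1 h₂))

end Hom

end MixedHodgeStructure

/-! ### The Hodge-number box of a pair from the boxes of `X` and `D` -/

namespace SchemePair

open CategoryTheory Literature.AlgebraicTopology.SingularHomology

variable {k : Type} [Field k] [Algebra k ℂ]

/-- `H⁰((X, D)) → H⁰((X, ∅))` is injective: it is `H⁰(X(ℂ), D(ℂ)) → H⁰(X(ℂ))` up to the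
isomorphism `absIso` (`map_ofSchemeHom_comp_absIso_hom`), and in degree `0` there are no
coboundaries, so a relative `0`-cocycle which is zero as an absolute class is zero
(Hatcher 2002, §3.1, pp. 199–200). [cite: Hatcher2002, §3.1 p. 200] -/
theorem injective_map_ofSchemeHom_zero (Y : SchemePair k) :
    Function.Injective (bettiCohomology.map (ofSchemeHom Y) 0).hom := by
  haveI : Mono ((relCochainComplex.ι ℚ ℚ (Y.pointsSub ℂ)).f 0) :=
    (ModuleCat.mono_iff_injective _).2 relCochainComplex.ι_f_injective
  haveI : Mono (relSingularCohomology.toAbsolute ℚ ℚ (ComplexPoints Y.X) (Y.pointsSub ℂ) 0) :=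
    HomologicalComplex.mono_homologyMap_of_mono_of_not_rel (relCochainComplex.ι ℚ ℚ (Y.pointsSub ℂ)) 0
      (fun i (h : i + 1 = 0) => by omega)
  haveI : Mono (bettiCohomology.map (ofSchemeHom Y) 0) :=
    mono_of_mono_fac (map_ofSchemeHom_comp_absIso_hom Y 0)
  exact (ModuleCat.mono_iff_injective _).1 inferInstance

/-- **The box of `Hⁿ⁺¹((X, D))` from the boxes of `Hⁿ((D, ∅))` and `Hⁿ⁺¹((X, ∅))`** (Deligne,
Hodge III, Thm. 8.2.4 for `X` and `D` ⟹ the bound for the pair, through the exact sequence 8.3.9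
`Hⁿ((D, ∅)) → Hⁿ⁺¹((X, D)) → Hⁿ⁺¹((X, ∅))` of mixed Hodge structures and the exactness of the
`(p, q)`-pieces, Hodge II, 2.3.5 (iv); Cattani et al., Prop. 3.4.22 (iii); Ishii, Prop. 8.1.4 with
Thm. 8.1.6 (iii)). The mixed Hodge structures are arbitrary; the hypotheses are that the two
maps of the pair sequence underlie morphisms (`φ`, `ψ`) and the two boxes; the exactness is the
tree's `exact_boundary_map_ofSchemeHom`. [cite: DeligneHodgeIII1974, Thm. 8.2.4 and 8.3.9] -/
theorem piece_gr_eq_bot_of_not_mem_box_succ (Y : SchemePair k) (n : ℕ)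
    {HD : MixedHodgeStructure ((ofScheme Y.D).bettiCohomology n)}
    {HXD : MixedHodgeStructure (Y.bettiCohomology (n + 1))}
    {HX : MixedHodgeStructure ((ofScheme Y.X).bettiCohomology (n + 1))}
    (φ : MixedHodgeStructure.Hom HD HXD)
    (hφ : φ.toLinearMap = (bettiCohomology.boundary Y n).hom)
    (ψ : MixedHodgeStructure.Hom HXD HX)
    (hψ : ψ.toLinearMap = (bettiCohomology.map (ofSchemeHom Y) (n + 1)).hom)
    (hD : ∀ p q : ℤ, ¬(0 ≤ p ∧ p ≤ n ∧ 0 ≤ q ∧ q ≤ n) → (HD.gr (p + q)).piece p q = ⊥)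
    (hX : ∀ p q : ℤ, ¬(0 ≤ p ∧ p ≤ (n + 1 : ℕ) ∧ 0 ≤ q ∧ q ≤ (n + 1 : ℕ)) →
      (HX.gr (p + q)).piece p q = ⊥)
    (p q : ℤ) (hpq : ¬(0 ≤ p ∧ p ≤ (n + 1 : ℕ) ∧ 0 ≤ q ∧ q ≤ (n + 1 : ℕ))) :
    (HXD.gr (p + q)).piece p q = ⊥ := by
  have hex : Function.Exact (bettiCohomology.boundary Y n).hom
      (bettiCohomology.map (ofSchemeHom Y) (n + 1)).hom :=
    LinearMap.exact_iff.2 (exact_boundary_map_ofSchemeHom Y n).moduleCat_range_eq_ker.symm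
  rw [← hφ, ← hψ] at hex
  refine MixedHodgeStructure.Hom.piece_gr_eq_bot_of_exact hex (hD p q ?_) (hX p q hpq)
  rintro ⟨h0p, hpn, h0q, hqn⟩
  exact hpq ⟨h0p, by omega, h0q, by omega⟩

/-- **The box of `H⁰((X, D))` from the box of `H⁰((X, ∅))`**: `H⁰((X, D)) → H⁰((X, ∅))` is an
injective morphism of mixed Hodge structures (`injective_map_ofSchemeHom_zero`), so the Hodge
pieces of `H⁰((X, D))` vanish where those of `H⁰((X, ∅))` do (Hodge II, 2.3.5 (iv)); with
`piece_gr_eq_bot_of_not_mem_box_succ` this covers every degree of the pair.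
[cite: DeligneHodgeIII1974, Thm. 8.2.4 and 8.3.9] -/
theorem piece_gr_eq_bot_of_not_mem_box_zero (Y : SchemePair k)
    {HXD : MixedHodgeStructure (Y.bettiCohomology 0)}
    {HX : MixedHodgeStructure ((ofScheme Y.X).bettiCohomology 0)}
    (ψ : MixedHodgeStructure.Hom HXD HX)
    (hψ : ψ.toLinearMap = (bettiCohomology.map (ofSchemeHom Y) 0).hom)
    (hX : ∀ p q : ℤ, ¬(0 ≤ p ∧ p ≤ (0 : ℕ) ∧ 0 ≤ q ∧ q ≤ (0 : ℕ)) → (HX.gr (p + q)).piece p q = ⊥)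
    (p q : ℤ) (hpq : ¬(0 ≤ p ∧ p ≤ (0 : ℕ) ∧ 0 ≤ q ∧ q ≤ (0 : ℕ))) :
    (HXD.gr (p + q)).piece p q = ⊥ := by
  have hinj : Function.Injective ψ.toLinearMap := by
    rw [hψ]
    exact injective_map_ofSchemeHom_zero Y
  exact ψ.piece_gr_eq_bot_of_injective hinj (hX p q hpq)

end SchemePair

/-! ### The box axiom of `MixedHodgeStructureOfPair` for pairs follows from the box for varieties -/

namespace MixedHodgeStructureOfPair

variable {k : Type} [Field k] [Algebra k ℂ]

/-- **Reduction of the fifth axiom of `existsDeligne` to Deligne's Thm. 8.2.4 as printed.**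
Mixed Hodge structures `mhs Y n` on all `Hⁿ(X(ℂ), D(ℂ); ℚ)` which are functorial for morphisms
of pairs of varieties (`map_hom`), for which the connecting maps are morphisms (`boundary_hom`),
pure of weight `n` on smooth projective varieties (`isPure`), and whose Hodge numbers satisfy
Deligne's bound `h^{p,q}(Hⁿ(X)) = 0` unless `0 ≤ p, q ≤ n` **for varieties** `X` — i.e. for the
pairs `(X, ∅)` (Hodge III, Thm. 8.2.4) — already form a `MixedHodgeStructureOfPair k`: the bound
for an arbitrary pair of varieties `(X, D)` follows in degree `0` from the injective morphism
`H⁰((X, D)) → H⁰((X, ∅))` and in degree `n + 1` from the exact sequence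
`Hⁿ((D, ∅)) → Hⁿ⁺¹((X, D)) → Hⁿ⁺¹((X, ∅))` of mixed Hodge structures (Hodge III, 8.3.9) by the
exactness of the `(p, q)`-pieces (Hodge II, 2.3.5 (iv)), `(X, ∅)` and `(D, ∅)` being pairs of
varieties (`IsVarietyPair.ofScheme_X`, `IsVarietyPair.ofScheme_D`).
[cite: DeligneHodgeIII1974, Thm. 8.2.4 and 8.3.9] -/
theorem nonempty_of_box_ofScheme
    (mhs : (Y : SchemePair k) → (n : ℕ) → MixedHodgeStructure (Y.bettiCohomology n))
    (map_hom : ∀ ⦃Y Y' : SchemePair k⦄, Y.IsVarietyPair → Y'.IsVarietyPair → ∀ (f : Y ⟶ Y') (n : ℕ),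
      ∃ φ : MixedHodgeStructure.Hom (mhs Y' n) (mhs Y n),
        φ.toLinearMap = (SchemePair.bettiCohomology.map f n).hom)
    (boundary_hom : ∀ ⦃Y : SchemePair k⦄, Y.IsVarietyPair → ∀ n : ℕ,
      ∃ φ : MixedHodgeStructure.Hom (mhs (SchemePair.ofScheme Y.D) n) (mhs Y (n + 1)),
        φ.toLinearMap = (SchemePair.bettiCohomology.boundary Y n).hom)
    (isPure : ∀ ⦃d : ℕ⦄ ⦃X : SchemeOver k⦄, IsSmoothProjective d X → ∀ n : ℕ,
      (mhs (SchemePair.ofScheme X) n).IsPure n)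
    (box_ofScheme : ∀ ⦃X : SchemeOver k⦄, (SchemePair.ofScheme X).IsVarietyPair →
      ∀ (n : ℕ) (p q : ℤ), ¬(0 ≤ p ∧ p ≤ n ∧ 0 ≤ q ∧ q ≤ n) →
        ((mhs (SchemePair.ofScheme X) n).gr (p + q)).piece p q = ⊥) :
    Nonempty (MixedHodgeStructureOfPair k) := by
  refine ⟨⟨mhs, map_hom, boundary_hom, isPure, ?_⟩⟩
  intro Y hY n p q hpq
  cases n with
  | zero =>
    obtain ⟨ψ, hψ⟩ := map_hom hY.ofScheme_X hY (SchemePair.ofSchemeHom Y) 0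
    exact SchemePair.piece_gr_eq_bot_of_not_mem_box_zero Y ψ hψ (box_ofScheme hY.ofScheme_X 0) p q hpq
  | succ n =>
    obtain ⟨φ, hφ⟩ := boundary_hom hY n
    obtain ⟨ψ, hψ⟩ := map_hom hY.ofScheme_X hY (SchemePair.ofSchemeHom Y) (n + 1)
    exact SchemePair.piece_gr_eq_bot_of_not_mem_box_succ Y n φ hφ ψ hψ
      (box_ofScheme hY.ofScheme_D n) (box_ofScheme hY.ofScheme_X (n + 1)) p q hpq

end MixedHodgeStructureOfPair

/-! ### Parity: what any inhabitant of `MixedHodgeStructureOfPair k` already contains -/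

namespace HodgeStructure

universe u

variable {V : Type u} [AddCommGroup V] [Module ℚ V] {n : ℤ}

/-- **A `ℚ`-Hodge structure of odd weight lives on an even-dimensional space.** For
`n = 2m + 1` the opposedness axiom at `(p, q) = (m + 1, m + 1)` reads
`V_ℂ = F^{m+1} ⊕ conj F^{m+1}`, and `dim_ℂ conj F^{m+1} = dim_ℂ F^{m+1}`
(`finrank_complexConj`, `WeilTypeCMProofs.lean`), so
`dim_ℚ V = dim_ℂ V_ℂ = 2 dim_ℂ F^{m+1}` — the linear algebra behind Voisin, *Hodge Theory I*,
Cor. 6.13 ("the odd Betti numbers of a compact Kähler manifold are even"). For `V` of infinite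
dimension `finrank` is `0`, also even. [cite: VoisinHodgeI2002, Cor. 6.13] -/
theorem even_finrank_of_odd (H : HodgeStructure V n) (hn : Odd n) : Even (Module.finrank ℚ V) := by
  by_cases hfin : Module.Finite ℚ V
  · haveI : Module.Finite ℚ V := hfin
    obtain ⟨m, rfl⟩ := hn
    have hc : IsCompl (H.F (m + 1)) (complexConj (H.F (m + 1))) :=
      H.isCompl_F_complexConj (m + 1) (m + 1) (by ring)
    have h := finrank_add_finrank_complexConj (H.F (m + 1)) hc
    rw [finrank_complexConj] at h
    exact ⟨Module.finrank ℂ (H.F (m + 1)), h.symm⟩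
  · rw [Module.finrank_of_not_finite hfin]
    exact Even.zero

end HodgeStructure

namespace MixedHodgeStructure

universe u

variable {V : Type u} [AddCommGroup V] [Module ℚ V]

/-- **A mixed Hodge structure which is pure of odd weight lives on an even-dimensional space**:
if `W_{n-1} = 0` and `W_n = V` (`IsPure n`) then `Gr^W_n = V` and `H.gr n` is a pure Hodge
structure of the odd weight `n` on it (`HodgeStructure.even_finrank_of_odd`).
[cite: VoisinHodgeI2002, Cor. 6.13] -/
theorem even_finrank_of_isPure_odd (H : MixedHodgeStructure V) {n : ℤ} (hH : H.IsPure n)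
    (hn : Odd n) : Even (Module.finrank ℚ V) := by
  have h := (H.gr n).even_finrank_of_odd hn
  have hbot : subPiece H.W n = ⊥ := by
    rw [subPiece, Submodule.submoduleOf, hH.1 (n - 1) (by omega), Submodule.comap_bot,
      Submodule.ker_subtype]
  have htop : H.W n = ⊤ := hH.2 n le_rfl
  let e : grW H.W n ≃ₗ[ℚ] V :=
    (Submodule.quotEquivOfEqBot _ hbot).trans
      ((LinearEquiv.ofEq _ _ htop).trans Submodule.topEquiv)
  rwa [e.finrank_eq] at h

end MixedHodgeStructure

namespace MixedHodgeStructureOfPair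

variable {k : Type} [Field k] [Algebra k ℂ]

/-- **The odd Betti numbers of a smooth projective variety are even, for any inhabitant of
`MixedHodgeStructureOfPair k`.** By the axiom `isPure`, `Hⁿ(X(ℂ); ℚ) = Hⁿ((X, ∅))` carries a
mixed Hodge structure pure of weight `n`; for `n` odd its dimension is therefore even
(`MixedHodgeStructure.even_finrank_of_isPure_odd`). This is Voisin, *Hodge Theory I*, Cor. 6.13
("The odd Betti numbers `b_{2k+1}` of a compact Kähler manifold are even") for `X(ℂ)`, obtained
here formally from the hypothesis structure: it is the numerical shadow of the Hodge
decomposition that every inhabitant — in particular Deligne's (`existsDeligne`) — must carry, and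
the reason no inhabitant can be written down in the tree short of `isInternal_hodgePQ`.
(`finrank` is `0`, hence even, off finite-dimensional cohomology; no finiteness is assumed.)
[cite: VoisinHodgeI2002, Cor. 6.13] -/
theorem even_finrank_bettiCohomology_of_odd (M : MixedHodgeStructureOfPair k) {d : ℕ}
    {X : SchemeOver k} (hX : IsSmoothProjective d X) {n : ℕ} (hn : Odd n) :
    Even (Module.finrank ℚ ((SchemePair.ofScheme X).bettiCohomology n)) :=
  (M.mhs (SchemePair.ofScheme X) n).even_finrank_of_isPure_odd (M.isPure hX n) (by exact_mod_cast hn)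

/-- **Corollary of `existsDeligne`**: for every subfield `k ⊆ ℂ`, every smooth projective
`k`-variety `X` and every odd `n`, `dim_ℚ Hⁿ(X(ℂ); ℚ)` is even (Voisin, *Hodge Theory I*,
Cor. 6.13, through Deligne's mixed Hodge structures: `even_finrank_bettiCohomology_of_odd` for the
inhabitant the fact provides). [cite: VoisinHodgeI2002, Cor. 6.13] -/
theorem existsDeligne.even_finrank_bettiCohomology_of_odd (h : existsDeligne) (k : Type) [Field k]
    [Algebra k ℂ] {d : ℕ} {X : SchemeOver k} (hX : IsSmoothProjective d X) {n : ℕ} (hn : Odd n) :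
    Even (Module.finrank ℚ ((SchemePair.ofScheme X).bettiCohomology n)) := by
  obtain ⟨M⟩ := h k
  exact M.even_finrank_bettiCohomology_of_odd hX hn

end MixedHodgeStructureOfPair

end Literature.AlgebraicGeometry.Motives

end
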